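import Summits.QuantumFields.YangMills.Theorems.BalabanUVNodesN11TopPairLocalResidual
import Literature.MathematicalPhysics.QuantumFieldTheory.Balaban1983to89.Node00.Record13SepCoPHV

/-!
EDITION v1.1 (dag-n11-d g31, 2026-08-29; T0′ of the FLAG №1 R2b cure): every `(hloc : (θ.Zh …).LocalLaws)` below now DISPLAYS the one-scale law it uses, and the proviso-keyed
corollaries take it as `hzh` (K1-face theorems: as an extra hypothesis inside the run-indexed chain) instead of reading it off the row `zhLocal`, which the cure re-types IN PLACE to
print's two-scale law ([III] (3.1)–(3.4) pp.264–267).  Content unchanged: «at every θ whose step-1 residuals are one-scale», no longer «at every lawful θ».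

# DAG node N11 — THE MAIN TERM AT EVERY PARAMETER WHOSE STEP-1 RESIDUAL IS ONE-SCALE (`hzh`, displayed), POST-𝐑 SIDE: the level-`1` DENSITY's top-pair slot is a pointwise multiple of the 𝐓-slot ([IV] (0.3)), so the same test
# reads the §2 FORM OF `ρ₁` — [B16] Thm 1's `Sect2Form 1`, the (B) conjunct of K1⁹ — and at every `θ : Stage13HParams F 2` whose step-1 residual obeys the displayed one-scale law `hzh` (NOT implied by K1⁹'s provisos since W2∕T1′) the form serves the top
# pair `(Ω₁, Λ₁) = (𝕋, 𝕋)` only with a slot vanishing a.e. on its support: K1⁹'s own (B) face + `hzh` ⇒ along every run in Theorem 1's window with `1 ≤ K` (guards at the run), the first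
# effective density carries NO all-small-field term (count-neutral, LOCATED)

HEADER — WORK-UNIT METADATA.  Cell `pub-ymgap`, YM-PLAN Track A (HUMAN RULING D-0062), seat `pub-ymgap-dag-n11-d` (g19; N11 [B14], s2), route `BalabanUVNodes`, item K1⁹ =
stmt-QuantumFields-27364 (helper lane, `--kind proof --supports 27364 --as helper`, count-neutral).  [III] = [Balaban1988Convergent], [IV] = [Balaban1989LargeFieldI], [B16] =
[Balaban1989LargeFieldII], [B7] = [Balaban1985Averaging].  Over this seat's g19 `…N11TopPairLocalResidual` (the constant prefactor `c` under the displayed one-scale law `hzh`; `top_prefactor_eq_zero_iff_of_localLaws`,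
`sect2Slot_top_pair_eq_zero_of_localLaws`), g18 `…N11TopPairRoughSet.slotsT_one_top_ae_zero_on_rough` ∕ `…N11TopPairRoughWitness.rough_support_ne_zero_of_lt_dist1`, node00-def-T's slot recursion
(`Node00.RepTowerOfRecord.slotsOfRecord_succ`), node00-def-R's `R` on slots (`rstepSlotOfRecord` ∕ `rstepSlot` ∕ `rstepOfSel`: `slot′(s′)(V) = slot(s′)(V) · Σ ratio`), RECORD 13 v1.7 `H` ∕ v1.8 `V`
(`Node00/Record13CoPH`: `sLaw₁₃CoPH_iff`; `Node00/Record13SepCoPH`: `sect2Form_stage13SepCoPH_iff`; `Node00/Record13SepCoPHV`: `datumOfRecord₁₃SepCoPHV`, `thm1Printed_datumOfRecord₁₃SepCoPHV_iff`,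
`sect2Form_datumOfRecord₁₃SepCoPHV_iff`), `B16.EndStatementBPrinted` ∕ `B16.Thm1Printed`, `B14Cor3.inInterval_of_le`.

WHY THIS FILE.  `…N11TopPairLocalResidual` §5 reads the first 𝐓-law `TLaw₁₃CoPH θ p 0` (the PRE-𝐑 slot family, level 1).  K1⁹'s consequent does not display that law; it displays the
(B) face `B16.EndStatementBPrinted (datumOfRecord₁₃SepCoPHV F 2 θ h v).C`, whose first conjunct `B16.Thm1Printed` is «`∃ γ > 0`, along every run in the `γ`-window, `Sect2Form k` for all
`k ≤ K`» — the §2 form of the POST-𝐑 densities `ρ_k`, version-free (`thm1Printed_datumOfRecord₁₃SepCoPHV_iff`), and at Stage 13 `Sect2Form k` IS `HasSect2FormAEZS k` of the post-𝐑 slot family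
(`sect2Form_stage13SepCoPH_iff` = `sLaw₁₃CoPH_iff`).  By [IV] (0.3) as typed, the post-𝐑 slot is the pre-𝐑 slot times a ratio sum, POINTWISE (`slotsOfRecord_succ` + def-R's `rstepOfSel`): so
the level-`1` density's top-pair slot vanishes wherever the 𝐓-slot does — a.e. on the rough coarse fields (g18) — while its §2-form value is the same `c · e^{−½quad} · exp A_1` with the
`V′`-INDEPENDENT `c` of `…N11TopPairLocalResidual` (same weights, residual and background map at level `1`).  Hence the same trichotomy and the same conclusion for `Sect2Form 1`: at every
`θ : Stage13HParams F 2` whose step-1 residuals obey `hzh`, under the numerics guards at the run, the top pair's POST-𝐑 slot is the zero function or vanishes a.e. on `{χ₁ ≠ 0}` — read straight off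
K1⁹'s (B) face (+ `hzh`) along every run in Theorem 1's window with `1 ≤ K` (§4), and at SOME run by K1⁹'s own non-vacuity window (§4, `B14Cor3.inInterval_of_le`).

WHAT THIS FILE PROVES (0 `def`, 0 `sorry`, standard axioms).  §1 `slotsOfRecord_succ_apply_eq_zero_of_slotsT` (pointwise [IV] (0.3): `slotT_{k+1}(s′)(V) = 0 ⇒ slot_{k+1}(s′)(V) = 0`) ·
`slots_succ_ae_zero_on_of_slotsT` · ★★ `slots_one_top_ae_zero_on_rough` (every `θ`: the level-`1` density's top-pair slot vanishes for a.e. rough `V′`).  §2 ★★★ `top_S_trichotomy_of_localLaws` ·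
★★★ `main_term_absent_postR_of_localLaws` · `…_of_lt_dist1` · ★★★★ `…_su2`.  §3 ★★★★★ `sLaw₁₃CoPH_one_top_pair_degenerate_su2` (every `θ : Stage13HParams F 2` obeying `hzh` + guards — no proviso read:
`SLaw₁₃CoPH θ p 1` ⇒ the top pair's post-𝐑 slot is the zero function or vanishes a.e. on its support).  §4 ★★★★★★ `endStatementBPrinted_top_pair_degenerate_su2` (K1⁹'s (B) conjunct at
`(θ, h, v)` + `hzh` ⇒ `∃ γ > 0`, along every run in the `γ`-window with `1 ≤ K` and the guards, every top pair's post-𝐑 slot degenerate) · ★★★★★★ `exists_run_top_pair_degenerate_of_endStatementBPrinted_su2`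
(plus K1⁹'s non-vacuity window ⇒ such a run EXISTS).

HONEST FRAMING.  A NECESSARY-CONDITION reading on the tree's own rows and objects (count-neutral, LOCATED; repair census in `…N11TopPairLocalResidual`'s header: def-R's unit branch of the (3.2)
indicator × 11a's base-configuration reading × 12b's `zeta0_local`): nothing of Bałaban asserted or refuted; K1⁹ NOT refuted (the other level-1 children may carry `ρ₁`; no positivity of
def-T's transports is claimed); N11 NOT discharged; K1⁹ NOT closed; no registered stub touched; counts unmoved (typed 28∕28 · discharged 5∕27 · A 5∕28); NOT ℝ⁴ ∕ OS ∕ mass gap ∕ Clay.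
No `sorry`, `axiom`, `def`, `instance`, `notation`.  Sources (SHAPE only): [III] Thm 1 p.262, (2.18) p.257, (2.21)–(2.23) p.258, p.267, (3.1)–(3.5) pp.264–265, (3.25) p.270; [IV] (0.3)
p.176; [B16] Thm 1 p.355; [B7] Prop. 2 (52)–(54) p.26; [I] = [Balaban1987RG1] Thm 1 p.259.
-/

noncomputable section

open MeasureTheory
open scoped BigOperators Matrix.Norms.L2Operator

namespace Summit.QuantumFields.YangMills.Theorems.BalabanUVNodesN11TopPairLocalResidualPostR

open Literature.MathematicalPhysics.QuantumFieldTheory.Balaban1983to89 T4Continuum Node00 Node00.Tk B14.Eq218Concrete B14.Sect3Decomp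
open Literature.MathematicalPhysics.QuantumFieldTheory.Balaban1983to89.ExpMeanLog (deltaSU)
open B14.Eq213MaximalDomains (side)
open BalabanUVNodesN11AllLargeFieldLabel (sideD_pos sideχ_pos)
open BalabanUVNodesN11TopPairRoughSet (slotsT_one_top_ae_zero_on_rough)
open BalabanUVNodesN11TopPairRoughWitness (rough_support_ne_zero_of_lt_dist1)
open BalabanUVNodesN11TopPairLocalResidual (top_prefactor_eq_zero_iff_of_localLaws sect2Slot_top_pair_eq_of_localLaws sect2Slot_top_pair_eq_zero_of_localLaws)
open Summit.QuantumFields.YangMills.BalabanUVNodes.N07Thm1ScaledInterfaceInstance (su2_dist1_surj)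

variable {F : T4Family} {N : ℕ} [NeZero N]

/-! ## §1. [IV] (0.3) pointwise: the post-𝐑 slot vanishes wherever the pre-𝐑 slot does; the top pair's post-𝐑 slot on the rough coarse fields -/

section PostR

variable (ν : Stage7Numerics) (τ : TowerNumerics) (E : B12.RunParams → ℝ) (w : StepWeightsOfRecord F N ν τ.M) (ppSel : PpSelOfRecord F ν τ.M)
variable (p : B12.RunParams) (g : ℕ → ℝ)

/-- **[IV] (0.3) POINTWISE**: `slot_{k+1}(s′)(V) = slotT_{k+1}(s′)(V) · Σ_{a : sel a = s′} ratio(a, s′)(V)` (def-T `slotsOfRecord_succ`, def-R `rstepOfSel`), so a vanishing 𝐓-slot VALUE gives a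
vanishing post-𝐑 slot VALUE — any selector, no proviso. [cite: Balaban1989LargeFieldI, (0.3) p.176; Balaban1988Convergent, (3.24) p.270] -/
theorem slotsOfRecord_succ_apply_eq_zero_of_slotsT {k : ℕ} (s' : SeqOfRecord F ν τ.M g p.K (k + 1)) (V : GaugeField (F.P p.K) (k + 1) (SU N))
    (h0 : slotsTOfRecord F N ν τ E w ppSel p g (k + 1) s' V = 0) : slotsOfRecord F N ν τ E w ppSel p g (k + 1) s' V = 0 := by
  rw [slotsOfRecord_succ]
  show slotsTOfRecord F N ν τ E w ppSel p g (k + 1) s' V * _ = 0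
  rw [h0, zero_mul]

/-- **… a.e. ON ANY EVENT**: if the 𝐓-slot vanishes a.e. on `{P}`, so does the post-𝐑 slot. [cite: Balaban1989LargeFieldI, (0.3) p.176 (bookkeeping)] -/
theorem slots_succ_ae_zero_on_of_slotsT {k : ℕ} (s' : SeqOfRecord F ν τ.M g p.K (k + 1)) (P : GaugeField (F.P p.K) (k + 1) (SU N) → Prop)
    (h : ∀ᵐ V ∂fieldMeasure (F.P p.K) (k + 1) (SU N), P V → slotsTOfRecord F N ν τ E w ppSel p g (k + 1) s' V = 0) :
    ∀ᵐ V ∂fieldMeasure (F.P p.K) (k + 1) (SU N), P V → slotsOfRecord F N ν τ E w ppSel p g (k + 1) s' V = 0 := by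
  filter_upwards [h] with V hV hP
  exact slotsOfRecord_succ_apply_eq_zero_of_slotsT ν τ E w ppSel p g s' V (hV hP)

variable (A₁ : ℝ) (ζ : ZetaOfRecord F N ν τ.M)

/-- ★★ **EVERY `θ`: THE LEVEL-1 DENSITY's TOP-PAIR SLOT VANISHES FOR a.e. ROUGH `V′`** (g18's 𝐓-side `slotsT_one_top_ae_zero_on_rough` through (0.3)).
[cite: Balaban1988Convergent, (3.1)–(3.5) pp.264–265, (3.25) p.270; Balaban1989LargeFieldI, (0.3) p.176; Balaban1985Averaging, Prop. 2 (53) p.26] -/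
theorem slots_one_top_ae_zero_on_rough (hK : 0 < p.K) (hD : 0 < sideD F ν τ.M p g 0) (hχ : 0 < sideχ F ν p g 0) {α₀ : ℝ} (hα : 0 < α₀)
    (hα3 : (143 * (((((F.P p.K).d + 4 : ℕ) : ℝ)) ^ 2 / 4) ^ 2) * α₀ ≤ 1 / 3)
    (hα2 : 2 * α₀ ≤ 2 * deltaSU (Fin N) / ((((F.P p.K).d + 4) * (F.P p.K).L : ℕ) : ℝ) ^ 2)
    (hαε : epsOfRecord ν g 1 * (F.P p.K).eta 1 ^ 2 + 4 * (2 * deltaOfRecord ν g 0 A₁) ≤ α₀ * (F.P p.K).eta 1 ^ 2)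
    (s' : SeqOfRecord F ν τ.M g p.K 1) (hΩ : s'.Ω 1 = Set.univ) (hΛ : s'.Λ 1 = Set.univ) :
    ∀ᵐ V' ∂fieldMeasure (F.P p.K) 1 (SU N), ¬ PlaqSmall (2 * α₀ * (((F.P p.K).L : ℝ) ^ 1 * (F.P p.K).eta 1) ^ 2) V' →
      slotsOfRecord F N ν τ E (wOfRecord F N ν τ.M A₁ ζ) ppSel p g 1 s' V' = 0 :=
  slots_succ_ae_zero_on_of_slotsT ν τ E (wOfRecord F N ν τ.M A₁ ζ) ppSel p g s' _
    (slotsT_one_top_ae_zero_on_rough ν τ E A₁ ζ ppSel p g hK hD hχ hα hα3 hα2 hαε s' hΩ hΛ)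

end PostR

/-! ## §2. The test on the post-𝐑 side at every `θ` obeying the displayed one-scale law -/

section Test

variable (θ : Stage13HParams F N) (p : B12.RunParams)

/-- ★★★ **THE POST-𝐑 TRICHOTOMY AT EVERY `θ` OBEYING THE ROW**: for `s′ = (𝕋, 𝕋)` and any level-1 terms `(u₁, e₁)`, the §2-form clause of the post-𝐑 slot — «`slot_1(s′) ≡ 0 ∨ slot_1(s′) =
sect2Slot(W^θ(s′), …)` a.e. on `{χ₁(s′) ≠ 0}`» — implies `slot_1(s′) ≡ 0 ∨ c = 0 ∨ {χ₁(s′) ≠ 0 ∧ ¬PlaqSmall(2α₀(Lη₁)²)}` is `dV′`-null, `c = ζ_0(∅)(base₁ 1)`.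
[cite: Balaban1988Convergent, Thm 1 p.262, (2.18) p.257, (3.1)–(3.5) pp.264–265, p.267; Balaban1989LargeFieldI, (0.3) p.176; Balaban1985Averaging, Prop. 2 (53) p.26] -/
theorem top_S_trichotomy_of_localLaws (hM : 1 ≤ θ.τ9.M) (hM₂ : 0 < θ.ν.M₂) (hK : 0 < p.K) {α₀ : ℝ} (hα : 0 < α₀)
    (hα3 : (143 * (((((F.P p.K).d + 4 : ℕ) : ℝ)) ^ 2 / 4) ^ 2) * α₀ ≤ 1 / 3)
    (hα2 : 2 * α₀ ≤ 2 * deltaSU (Fin N) / ((((F.P p.K).d + 4) * (F.P p.K).L : ℕ) : ℝ) ^ 2)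
    (hαε : epsOfRecord θ.ν (gOfRecord₁₃ F N θ.toStage13Params p) 1 * (F.P p.K).eta 1 ^ 2 + 4 * (2 * deltaOfRecord θ.ν (gOfRecord₁₃ F N θ.toStage13Params p) 0 θ.A₁) ≤
      α₀ * (F.P p.K).eta 1 ^ 2)
    (s' : SeqOfRecord F θ.ν θ.τ9.M (gOfRecord₁₃ F N θ.toStage13Params p) p.K 1) (hloc : ∀ Y ω ω', ω 0 = ω' 0 → (θ.Zh p 1 s'.Ω s'.Λ).ζ0 0 Y ω = (θ.Zh p 1 s'.Ω s'.Λ).ζ0 0 Y ω') (hΩ : s'.Ω 1 = Set.univ) (hΛ : s'.Λ 1 = Set.univ)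
    (u₁ : Sect2.TermValues (F.P p.K) (MatA N) (FluctV N) θ.τ9.M) (e₁ : ℝ)
    (hS : slotsOfRecord F N θ.ν θ.τ9 (EOfRecord₁₃ F N θ.toStage13Params) (wOfRecord₉ F N θ.toStage9Params) θ.ppSel p (gOfRecord₁₃ F N θ.toStage13Params p) 1 s' = 0 ∨
      ∀ᵐ V' ∂fieldMeasure (F.P p.K) 1 (SU N),
        chiSeqOfRecord F N θ.ν θ.τ9.M (gOfRecord₁₃ F N θ.toStage13Params p) p.K 1 s' V' ≠ 0 →
          slotsOfRecord F N θ.ν θ.τ9 (EOfRecord₁₃ F N θ.toStage13Params) (wOfRecord₉ F N θ.toStage9Params) θ.ppSel p (gOfRecord₁₃ F N θ.toStage13Params p) 1 s' V' =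
            sect2Slot F N (FluctV N) p.K (settingOfRecord₁₃ F N θ.toStage13Params p) (θ.rzAt p s') (WtOfRecord₁₃H F N θ p s') s' u₁ e₁
              (UbgOfRecord₁₃CoP F N θ.toStage13Params p 1 s') V') :
    slotsOfRecord F N θ.ν θ.τ9 (EOfRecord₁₃ F N θ.toStage13Params) (wOfRecord₉ F N θ.toStage9Params) θ.ppSel p (gOfRecord₁₃ F N θ.toStage13Params p) 1 s' = 0 ∨
      (WtOfRecord₁₃H F N θ p s').ζ 0 ∅ (baseCfg (V := FluctV N) 1 (fun _ => 1)) = 0 ∨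
      fieldMeasure (F.P p.K) 1 (SU N) {V' | chiSeqOfRecord F N θ.ν θ.τ9.M (gOfRecord₁₃ F N θ.toStage13Params p) p.K 1 s' V' ≠ 0 ∧
        ¬ PlaqSmall (2 * α₀ * (((F.P p.K).L : ℝ) ^ 1 * (F.P p.K).eta 1) ^ 2) V'} = 0 := by
  rcases hS with h0 | hid
  · exact Or.inl h0
  · by_cases hc : (WtOfRecord₁₃H F N θ p s').ζ 0 ∅ (baseCfg (V := FluctV N) 1 (fun _ => 1)) = 0
    · exact Or.inr (Or.inl hc)
    · refine Or.inr (Or.inr ?_)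
      have hz := slots_one_top_ae_zero_on_rough θ.ν θ.τ9 (EOfRecord₁₃ F N θ.toStage13Params) θ.ppSel p (gOfRecord₁₃ F N θ.toStage13Params p) θ.A₁ θ.ζ hK
        (sideD_pos θ.ν hM p _ 0) (sideχ_pos hM₂ p _ 0) hα hα3 hα2 hαε s' hΩ hΛ
      have h2 : ∀ᵐ V' ∂fieldMeasure (F.P p.K) 1 (SU N), ¬ (chiSeqOfRecord F N θ.ν θ.τ9.M (gOfRecord₁₃ F N θ.toStage13Params p) p.K 1 s' V' ≠ 0 ∧
          ¬ PlaqSmall (2 * α₀ * (((F.P p.K).L : ℝ) ^ 1 * (F.P p.K).eta 1) ^ 2) V') := by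
        filter_upwards [hid, hz] with V' hV' hzV' hboth
        have h1 := hV' hboth.1
        have hlhs : slotsOfRecord F N θ.ν θ.τ9 (EOfRecord₁₃ F N θ.toStage13Params) (wOfRecord₉ F N θ.toStage9Params) θ.ppSel p
            (gOfRecord₁₃ F N θ.toStage13Params p) 1 s' V' = 0 := hzV' hboth.2
        rw [hlhs, sect2Slot_top_pair_eq_of_localLaws θ p s' hloc hΩ hΛ] at h1
        -- `0 = c · e^{…} · e^{…}` with both exponentials positive: `c = 0`, contradiction
        rcases mul_eq_zero.1 h1.symm with h3 | h3
        · rcases mul_eq_zero.1 h3 with h4 | h4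
          · exact hc h4
          · exact absurd h4 (Real.exp_pos _).ne'
        · exact absurd h3 (Real.exp_pos _).ne'
      have h4 := ae_iff.1 h2
      simp only [not_not] at h4
      exact h4

/-- ★★★ **THE MAIN TERM IS ABSENT FROM THE LEVEL-1 DENSITY AT EVERY `θ` OBEYING THE ROW WHEN THE ROUGH ALL-(3.2)-SMALL COARSE FIELDS ARE NON-NULL** (displayed): the §2-form clause of the
top pair's post-𝐑 slot implies that slot is the zero function or vanishes a.e. on its support. [cite: Balaban1988Convergent, Thm 1 p.262, (2.18) p.257, (3.1)–(3.5) pp.264–265, p.267; Balaban1989LargeFieldI, (0.3) p.176; Balaban1985Averaging, Prop. 2 (53) p.26] -/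
theorem main_term_absent_postR_of_localLaws (hM : 1 ≤ θ.τ9.M) (hM₂ : 0 < θ.ν.M₂) (hK : 0 < p.K) {α₀ : ℝ} (hα : 0 < α₀)
    (hα3 : (143 * (((((F.P p.K).d + 4 : ℕ) : ℝ)) ^ 2 / 4) ^ 2) * α₀ ≤ 1 / 3)
    (hα2 : 2 * α₀ ≤ 2 * deltaSU (Fin N) / ((((F.P p.K).d + 4) * (F.P p.K).L : ℕ) : ℝ) ^ 2)
    (hαε : epsOfRecord θ.ν (gOfRecord₁₃ F N θ.toStage13Params p) 1 * (F.P p.K).eta 1 ^ 2 + 4 * (2 * deltaOfRecord θ.ν (gOfRecord₁₃ F N θ.toStage13Params p) 0 θ.A₁) ≤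
      α₀ * (F.P p.K).eta 1 ^ 2)
    (s' : SeqOfRecord F θ.ν θ.τ9.M (gOfRecord₁₃ F N θ.toStage13Params p) p.K 1) (hloc : ∀ Y ω ω', ω 0 = ω' 0 → (θ.Zh p 1 s'.Ω s'.Λ).ζ0 0 Y ω = (θ.Zh p 1 s'.Ω s'.Λ).ζ0 0 Y ω') (hΩ : s'.Ω 1 = Set.univ) (hΛ : s'.Λ 1 = Set.univ)
    (u₁ : Sect2.TermValues (F.P p.K) (MatA N) (FluctV N) θ.τ9.M) (e₁ : ℝ)
    (hR : fieldMeasure (F.P p.K) 1 (SU N) {V' | chiSeqOfRecord F N θ.ν θ.τ9.M (gOfRecord₁₃ F N θ.toStage13Params p) p.K 1 s' V' ≠ 0 ∧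
        ¬ PlaqSmall (2 * α₀ * (((F.P p.K).L : ℝ) ^ 1 * (F.P p.K).eta 1) ^ 2) V'} ≠ 0)
    (hS : slotsOfRecord F N θ.ν θ.τ9 (EOfRecord₁₃ F N θ.toStage13Params) (wOfRecord₉ F N θ.toStage9Params) θ.ppSel p (gOfRecord₁₃ F N θ.toStage13Params p) 1 s' = 0 ∨
      ∀ᵐ V' ∂fieldMeasure (F.P p.K) 1 (SU N),
        chiSeqOfRecord F N θ.ν θ.τ9.M (gOfRecord₁₃ F N θ.toStage13Params p) p.K 1 s' V' ≠ 0 →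
          slotsOfRecord F N θ.ν θ.τ9 (EOfRecord₁₃ F N θ.toStage13Params) (wOfRecord₉ F N θ.toStage9Params) θ.ppSel p (gOfRecord₁₃ F N θ.toStage13Params p) 1 s' V' =
            sect2Slot F N (FluctV N) p.K (settingOfRecord₁₃ F N θ.toStage13Params p) (θ.rzAt p s') (WtOfRecord₁₃H F N θ p s') s' u₁ e₁
              (UbgOfRecord₁₃CoP F N θ.toStage13Params p 1 s') V') :
    slotsOfRecord F N θ.ν θ.τ9 (EOfRecord₁₃ F N θ.toStage13Params) (wOfRecord₉ F N θ.toStage9Params) θ.ppSel p (gOfRecord₁₃ F N θ.toStage13Params p) 1 s' = 0 ∨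
      ∀ᵐ V' ∂fieldMeasure (F.P p.K) 1 (SU N),
        chiSeqOfRecord F N θ.ν θ.τ9.M (gOfRecord₁₃ F N θ.toStage13Params p) p.K 1 s' V' ≠ 0 →
          slotsOfRecord F N θ.ν θ.τ9 (EOfRecord₁₃ F N θ.toStage13Params) (wOfRecord₉ F N θ.toStage9Params) θ.ppSel p (gOfRecord₁₃ F N θ.toStage13Params p) 1 s' V' = 0 := by
  rcases top_S_trichotomy_of_localLaws θ p hM hM₂ hK hα hα3 hα2 hαε s' hloc hΩ hΛ u₁ e₁ hS with h0 | hc | hnull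
  · exact Or.inl h0
  · rcases hS with h0 | hid
    · exact Or.inl h0
    · refine Or.inr ?_
      filter_upwards [hid] with V' hV' hχ
      rw [hV' hχ, sect2Slot_top_pair_eq_zero_of_localLaws θ p s' hloc hΩ hΛ hc]
      rfl
  · exact absurd hnull hR

/-- ★★★ **… FROM ONE GROUP ELEMENT BEYOND THE THRESHOLD** (every `N`; `g₀ : SU N` with `2εreg < dist1 g₀`; the numerics guards displayed). [cite: Balaban1988Convergent, Thm 1 p.262, (3.1)–(3.5) pp.264–265, (2.12) p.256, p.267; Balaban1989LargeFieldI, (0.3) p.176; Balaban1985Averaging, Prop. 2 (53)–(54) p.26, (10) p.19; Balaban1987RG1, (0.4) p.253] -/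
theorem main_term_absent_postR_of_localLaws_of_lt_dist1 (hM : 1 ≤ θ.τ9.M) (hM₂ : 0 < θ.ν.M₂) (hK : 0 < p.K) {α₀ : ℝ} (hα : 0 < α₀)
    (hα3 : (143 * (((((F.P p.K).d + 4 : ℕ) : ℝ)) ^ 2 / 4) ^ 2) * α₀ ≤ 1 / 3)
    (hα2 : 2 * α₀ ≤ 2 * deltaSU (Fin N) / ((((F.P p.K).d + 4) * (F.P p.K).L : ℕ) : ℝ) ^ 2)
    (hαε : epsOfRecord θ.ν (gOfRecord₁₃ F N θ.toStage13Params p) 1 * (F.P p.K).eta 1 ^ 2 + 4 * (2 * deltaOfRecord θ.ν (gOfRecord₁₃ F N θ.toStage13Params p) 0 θ.A₁) ≤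
      α₀ * (F.P p.K).eta 1 ^ 2)
    (hαr : 2 * α₀ * (((F.P p.K).L : ℝ) ^ 1 * (F.P p.K).eta 1) ^ 2 ≤ 2 * θ.ν.εreg)
    (hε₁ : 0 < epsOfRecord θ.ν (gOfRecord₁₃ F N θ.toStage13Params p) 1 * (F.P p.K).eta 1 ^ 2) (hmK : 1 ≤ (F.P p.K).m + (F.P p.K).K) (hε : 0 < θ.ν.εreg)
    (hε3 : (143 * (((((F.P p.K).d + 4 : ℕ) : ℝ)) ^ 2 / 4) ^ 2) * θ.ν.εreg ≤ 1 / 3)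
    (hε2 : 2 * θ.ν.εreg ≤ 2 * deltaSU (Fin N) / ((((F.P p.K).d + 4) * (F.P p.K).L : ℕ) : ℝ) ^ 2)
    (hM1 : 1 ≤ θ.ν.M₁) (h3 : 3 * side (F.P p.K).L θ.ν.M₁ 1 ≤ sideχ F θ.ν p (gOfRecord₁₃ F N θ.toStage13Params p) 0)
    (g₀ : SU N) (hg₀ : 2 * θ.ν.εreg < dist1 g₀)
    (s' : SeqOfRecord F θ.ν θ.τ9.M (gOfRecord₁₃ F N θ.toStage13Params p) p.K 1) (hloc : ∀ Y ω ω', ω 0 = ω' 0 → (θ.Zh p 1 s'.Ω s'.Λ).ζ0 0 Y ω = (θ.Zh p 1 s'.Ω s'.Λ).ζ0 0 Y ω') (hΩ : s'.Ω 1 = Set.univ) (hΛ : s'.Λ 1 = Set.univ)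
    (u₁ : Sect2.TermValues (F.P p.K) (MatA N) (FluctV N) θ.τ9.M) (e₁ : ℝ)
    (hS : slotsOfRecord F N θ.ν θ.τ9 (EOfRecord₁₃ F N θ.toStage13Params) (wOfRecord₉ F N θ.toStage9Params) θ.ppSel p (gOfRecord₁₃ F N θ.toStage13Params p) 1 s' = 0 ∨
      ∀ᵐ V' ∂fieldMeasure (F.P p.K) 1 (SU N),
        chiSeqOfRecord F N θ.ν θ.τ9.M (gOfRecord₁₃ F N θ.toStage13Params p) p.K 1 s' V' ≠ 0 →
          slotsOfRecord F N θ.ν θ.τ9 (EOfRecord₁₃ F N θ.toStage13Params) (wOfRecord₉ F N θ.toStage9Params) θ.ppSel p (gOfRecord₁₃ F N θ.toStage13Params p) 1 s' V' =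
            sect2Slot F N (FluctV N) p.K (settingOfRecord₁₃ F N θ.toStage13Params p) (θ.rzAt p s') (WtOfRecord₁₃H F N θ p s') s' u₁ e₁
              (UbgOfRecord₁₃CoP F N θ.toStage13Params p 1 s') V') :
    slotsOfRecord F N θ.ν θ.τ9 (EOfRecord₁₃ F N θ.toStage13Params) (wOfRecord₉ F N θ.toStage9Params) θ.ppSel p (gOfRecord₁₃ F N θ.toStage13Params p) 1 s' = 0 ∨
      ∀ᵐ V' ∂fieldMeasure (F.P p.K) 1 (SU N),
        chiSeqOfRecord F N θ.ν θ.τ9.M (gOfRecord₁₃ F N θ.toStage13Params p) p.K 1 s' V' ≠ 0 →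
          slotsOfRecord F N θ.ν θ.τ9 (EOfRecord₁₃ F N θ.toStage13Params) (wOfRecord₉ F N θ.toStage9Params) θ.ppSel p (gOfRecord₁₃ F N θ.toStage13Params p) 1 s' V' = 0 :=
  main_term_absent_postR_of_localLaws θ p hM hM₂ hK hα hα3 hα2 hαε s' hloc hΩ hΛ u₁ e₁
    (rough_support_ne_zero_of_lt_dist1 θ.ν θ.τ9.M p (gOfRecord₁₃ F N θ.toStage13Params p) hε₁ hmK hε hε3 hε2 hM1 hM₂ h3 g₀ hg₀ hαr s' hΩ) hS

end Test

/-! ## §3. `SU(2)`, guards only: the §2 form of `ρ₁` (`SLaw₁₃CoPH θ p 1`) serves the top pair only degenerately -/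

section SU2

variable {F : T4Family} (θ : Stage13HParams F 2) (p : B12.RunParams)

/-- ★★★★ **AT `SU(2)` THE MAIN TERM IS ABSENT FROM THE LEVEL-1 DENSITY AT EVERY `θ` OBEYING THE ROW, GUARDS ONLY.** [cite: Balaban1988Convergent, Thm 1 p.262, (2.18) p.257, (3.1)–(3.5) pp.264–265, (2.12) p.256, p.267; Balaban1989LargeFieldI, (0.3) p.176; Balaban1985Averaging, Prop. 2 (52)–(54) p.26; Balaban1987RG1, (0.4) p.253] -/
theorem main_term_absent_postR_of_localLaws_su2 (hM : 1 ≤ θ.τ9.M) (hM₂ : 0 < θ.ν.M₂) (hK : 0 < p.K) {α₀ : ℝ} (hα : 0 < α₀)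
    (hα3 : (143 * (((((F.P p.K).d + 4 : ℕ) : ℝ)) ^ 2 / 4) ^ 2) * α₀ ≤ 1 / 3)
    (hα2 : 2 * α₀ ≤ 2 * deltaSU (Fin 2) / ((((F.P p.K).d + 4) * (F.P p.K).L : ℕ) : ℝ) ^ 2)
    (hαε : epsOfRecord θ.ν (gOfRecord₁₃ F 2 θ.toStage13Params p) 1 * (F.P p.K).eta 1 ^ 2 + 4 * (2 * deltaOfRecord θ.ν (gOfRecord₁₃ F 2 θ.toStage13Params p) 0 θ.A₁) ≤
      α₀ * (F.P p.K).eta 1 ^ 2)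
    (hαr : 2 * α₀ * (((F.P p.K).L : ℝ) ^ 1 * (F.P p.K).eta 1) ^ 2 ≤ 2 * θ.ν.εreg)
    (hε₁ : 0 < epsOfRecord θ.ν (gOfRecord₁₃ F 2 θ.toStage13Params p) 1 * (F.P p.K).eta 1 ^ 2) (hmK : 1 ≤ (F.P p.K).m + (F.P p.K).K) (hε : 0 < θ.ν.εreg)
    (hε3 : (143 * (((((F.P p.K).d + 4 : ℕ) : ℝ)) ^ 2 / 4) ^ 2) * θ.ν.εreg ≤ 1 / 3)
    (hε2 : 2 * θ.ν.εreg ≤ 2 * deltaSU (Fin 2) / ((((F.P p.K).d + 4) * (F.P p.K).L : ℕ) : ℝ) ^ 2)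
    (hM1 : 1 ≤ θ.ν.M₁) (h3 : 3 * side (F.P p.K).L θ.ν.M₁ 1 ≤ sideχ F θ.ν p (gOfRecord₁₃ F 2 θ.toStage13Params p) 0)
    (s' : SeqOfRecord F θ.ν θ.τ9.M (gOfRecord₁₃ F 2 θ.toStage13Params p) p.K 1) (hloc : ∀ Y ω ω', ω 0 = ω' 0 → (θ.Zh p 1 s'.Ω s'.Λ).ζ0 0 Y ω = (θ.Zh p 1 s'.Ω s'.Λ).ζ0 0 Y ω') (hΩ : s'.Ω 1 = Set.univ) (hΛ : s'.Λ 1 = Set.univ)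
    (u₁ : Sect2.TermValues (F.P p.K) (MatA 2) (FluctV 2) θ.τ9.M) (e₁ : ℝ)
    (hS : slotsOfRecord F 2 θ.ν θ.τ9 (EOfRecord₁₃ F 2 θ.toStage13Params) (wOfRecord₉ F 2 θ.toStage9Params) θ.ppSel p (gOfRecord₁₃ F 2 θ.toStage13Params p) 1 s' = 0 ∨
      ∀ᵐ V' ∂fieldMeasure (F.P p.K) 1 (SU 2),
        chiSeqOfRecord F 2 θ.ν θ.τ9.M (gOfRecord₁₃ F 2 θ.toStage13Params p) p.K 1 s' V' ≠ 0 →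
          slotsOfRecord F 2 θ.ν θ.τ9 (EOfRecord₁₃ F 2 θ.toStage13Params) (wOfRecord₉ F 2 θ.toStage9Params) θ.ppSel p (gOfRecord₁₃ F 2 θ.toStage13Params p) 1 s' V' =
            sect2Slot F 2 (FluctV 2) p.K (settingOfRecord₁₃ F 2 θ.toStage13Params p) (θ.rzAt p s') (WtOfRecord₁₃H F 2 θ p s') s' u₁ e₁
              (UbgOfRecord₁₃CoP F 2 θ.toStage13Params p 1 s') V') :
    slotsOfRecord F 2 θ.ν θ.τ9 (EOfRecord₁₃ F 2 θ.toStage13Params) (wOfRecord₉ F 2 θ.toStage9Params) θ.ppSel p (gOfRecord₁₃ F 2 θ.toStage13Params p) 1 s' = 0 ∨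
      ∀ᵐ V' ∂fieldMeasure (F.P p.K) 1 (SU 2),
        chiSeqOfRecord F 2 θ.ν θ.τ9.M (gOfRecord₁₃ F 2 θ.toStage13Params p) p.K 1 s' V' ≠ 0 →
          slotsOfRecord F 2 θ.ν θ.τ9 (EOfRecord₁₃ F 2 θ.toStage13Params) (wOfRecord₉ F 2 θ.toStage9Params) θ.ppSel p (gOfRecord₁₃ F 2 θ.toStage13Params p) 1 s' V' = 0 := by
  obtain ⟨g₀, hg₀⟩ := su2_dist1_surj 2 zero_le_two le_rfl
  have hd : (F.P p.K).d = 4 := rfl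
  have hεlt : 2 * θ.ν.εreg < dist1 g₀ := by
    rw [hg₀]
    rw [hd] at hε3
    norm_num at hε3
    linarith
  exact main_term_absent_postR_of_localLaws_of_lt_dist1 θ p hM hM₂ hK hα hα3 hα2 hαε hαr hε₁ hmK hε hε3 hε2 hM1 h3 g₀ hεlt s' hloc hΩ hΛ u₁ e₁ hS

/-- (v1.1, T0′ of the FLAG №1 R2b cure: the DISPLAYED one-scale law `hzh` of the step-1 residuals replaces the proviso structure, whose row `zhLocal` the cure re-types to print's two-scale law.) ★★★★★ **[B16] THM 1's §2 FORM AT LEVEL 1 SERVES EVERY TOP PAIR ONLY DEGENERATELY** — at every `θ : Stage13HParams F 2` whose step-1 residuals obey `hzh` (no proviso is read; name kept for the importers), under the numerics guards: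
`SLaw₁₃CoPH θ p 1` ⇒ at every history `s′ = (𝕋, 𝕋)` of length `1` the post-𝐑 slot of `ρ₁` is the zero function or vanishes a.e. on `{χ₁(s′) ≠ 0}` (the law's own witness terms
`(t s′, E s′)` feed §2). [cite: Balaban1988Convergent, Thm 1 p.262, (2.17)–(2.18) p.257, (3.1)–(3.5) pp.264–265, p.267; Balaban1989LargeFieldII, Thm 1 p.355; Balaban1989LargeFieldI, (0.3) p.176; Balaban1985Averaging, Prop. 2 (52)–(54) p.26] -/
theorem sLaw₁₃CoPH_one_top_pair_degenerate_su2 (hzh : ∀ (Ω Λ : ℕ → Set (Site (F.P p.K) 0)) Y ω ω', ω 0 = ω' 0 → (θ.Zh p 1 Ω Λ).ζ0 0 Y ω = (θ.Zh p 1 Ω Λ).ζ0 0 Y ω') (hM : 1 ≤ θ.τ9.M) (hM₂ : 0 < θ.ν.M₂) (hK : 0 < p.K) {α₀ : ℝ} (hα : 0 < α₀)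
    (hα3 : (143 * (((((F.P p.K).d + 4 : ℕ) : ℝ)) ^ 2 / 4) ^ 2) * α₀ ≤ 1 / 3)
    (hα2 : 2 * α₀ ≤ 2 * deltaSU (Fin 2) / ((((F.P p.K).d + 4) * (F.P p.K).L : ℕ) : ℝ) ^ 2)
    (hαε : epsOfRecord θ.ν (gOfRecord₁₃ F 2 θ.toStage13Params p) 1 * (F.P p.K).eta 1 ^ 2 + 4 * (2 * deltaOfRecord θ.ν (gOfRecord₁₃ F 2 θ.toStage13Params p) 0 θ.A₁) ≤
      α₀ * (F.P p.K).eta 1 ^ 2)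
    (hαr : 2 * α₀ * (((F.P p.K).L : ℝ) ^ 1 * (F.P p.K).eta 1) ^ 2 ≤ 2 * θ.ν.εreg)
    (hε₁ : 0 < epsOfRecord θ.ν (gOfRecord₁₃ F 2 θ.toStage13Params p) 1 * (F.P p.K).eta 1 ^ 2) (hmK : 1 ≤ (F.P p.K).m + (F.P p.K).K) (hε : 0 < θ.ν.εreg)
    (hε3 : (143 * (((((F.P p.K).d + 4 : ℕ) : ℝ)) ^ 2 / 4) ^ 2) * θ.ν.εreg ≤ 1 / 3)
    (hε2 : 2 * θ.ν.εreg ≤ 2 * deltaSU (Fin 2) / ((((F.P p.K).d + 4) * (F.P p.K).L : ℕ) : ℝ) ^ 2)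
    (hM1 : 1 ≤ θ.ν.M₁) (h3 : 3 * side (F.P p.K).L θ.ν.M₁ 1 ≤ sideχ F θ.ν p (gOfRecord₁₃ F 2 θ.toStage13Params p) 0)
    (hSL : SLaw₁₃CoPH F 2 θ p 1)
    (s' : SeqOfRecord F θ.ν θ.τ9.M (gOfRecord₁₃ F 2 θ.toStage13Params p) p.K 1) (hΩ : s'.Ω 1 = Set.univ) (hΛ : s'.Λ 1 = Set.univ) :
    slotsOfRecord F 2 θ.ν θ.τ9 (EOfRecord₁₃ F 2 θ.toStage13Params) (wOfRecord₉ F 2 θ.toStage9Params) θ.ppSel p (gOfRecord₁₃ F 2 θ.toStage13Params p) 1 s' = 0 ∨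
      ∀ᵐ V' ∂fieldMeasure (F.P p.K) 1 (SU 2),
        chiSeqOfRecord F 2 θ.ν θ.τ9.M (gOfRecord₁₃ F 2 θ.toStage13Params p) p.K 1 s' V' ≠ 0 →
          slotsOfRecord F 2 θ.ν θ.τ9 (EOfRecord₁₃ F 2 θ.toStage13Params) (wOfRecord₉ F 2 θ.toStage9Params) θ.ppSel p (gOfRecord₁₃ F 2 θ.toStage13Params p) 1 s' V' = 0 := by
  obtain ⟨t, Ek, -, hall⟩ := (sLaw₁₃CoPH_iff F 2 θ p 1).1 hSL
  exact main_term_absent_postR_of_localLaws_su2 θ p hM hM₂ hK hα hα3 hα2 hαε hαr hε₁ hmK hε hε3 hε2 hM1 h3 s' (hzh s'.Ω s'.Λ) hΩ hΛ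
    (t s') (Ek s') (hall s').2

end SU2

/-! ## §4. Read off K1⁹'s own (B) face -/

section K1Face

variable {F : T4Family} (θ : Stage13HParams F 2) (h : θ.Provisos₁₃SepCoPH F 2) (v : Revision₁₃ F 2 θ h)

/-- ★★★★★★ **K1⁹'s (B) CONJUNCT ⇒ THE FIRST EFFECTIVE DENSITY CARRIES NO ALL-SMALL-FIELD TERM (a.e.) ALONG EVERY RUN IN THEOREM 1's WINDOW WITH `1 ≤ K`** **(v1.1, T0′ of the FLAG №1 R2b cure: plus the DISPLAYED one-scale law of the step-1 residuals — after the cure the proviso row `zhLocal` is print's two-scale law and no longer yields it.)** (`SU(2)`, numerics guards at the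
run): `B16.EndStatementBPrinted (datumOfRecord₁₃SepCoPHV F 2 θ h v).C` ⇒ `∃ γ > 0, ∀ p`, `flow_p` in the `γ`-window ∧ `1 ≤ p.K` ∧ guards ⇒ at every history `s′ = (𝕋, 𝕋)` of length `1` the
post-𝐑 slot of `ρ₁` is the zero function or vanishes a.e. on `{χ₁(s′) ≠ 0}`.  (`Thm1Printed` is version-free and its `Sect2Form 1` IS `SLaw₁₃CoPH θ p 1`.)
[cite: Balaban1989LargeFieldII, Thm 1 p.355; Balaban1988Convergent, Thm 1 p.262, (2.17)–(2.18) p.257, (3.1)–(3.5) pp.264–265, p.267; Balaban1989LargeFieldI, (0.3) p.176; Balaban1985Averaging, Prop. 2 (52)–(54) p.26] -/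
theorem endStatementBPrinted_top_pair_degenerate_su2 (hB : B16.EndStatementBPrinted (datumOfRecord₁₃SepCoPHV F 2 θ h v).C) :
    ∃ γ : ℝ, 0 < γ ∧ ∀ p : B12.RunParams, ((datumOfRecord₁₃SepCoPHV F 2 θ h v).C p).flow.InInterval γ p.K → 1 ≤ p.K →
      1 ≤ θ.τ9.M → 0 < θ.ν.M₂ → ∀ {α₀ : ℝ}, 0 < α₀ →
      (143 * (((((F.P p.K).d + 4 : ℕ) : ℝ)) ^ 2 / 4) ^ 2) * α₀ ≤ 1 / 3 →
      2 * α₀ ≤ 2 * deltaSU (Fin 2) / ((((F.P p.K).d + 4) * (F.P p.K).L : ℕ) : ℝ) ^ 2 →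
      epsOfRecord θ.ν (gOfRecord₁₃ F 2 θ.toStage13Params p) 1 * (F.P p.K).eta 1 ^ 2 + 4 * (2 * deltaOfRecord θ.ν (gOfRecord₁₃ F 2 θ.toStage13Params p) 0 θ.A₁) ≤
        α₀ * (F.P p.K).eta 1 ^ 2 →
      2 * α₀ * (((F.P p.K).L : ℝ) ^ 1 * (F.P p.K).eta 1) ^ 2 ≤ 2 * θ.ν.εreg →
      0 < epsOfRecord θ.ν (gOfRecord₁₃ F 2 θ.toStage13Params p) 1 * (F.P p.K).eta 1 ^ 2 → 1 ≤ (F.P p.K).m + (F.P p.K).K → 0 < θ.ν.εreg →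
      (143 * (((((F.P p.K).d + 4 : ℕ) : ℝ)) ^ 2 / 4) ^ 2) * θ.ν.εreg ≤ 1 / 3 →
      2 * θ.ν.εreg ≤ 2 * deltaSU (Fin 2) / ((((F.P p.K).d + 4) * (F.P p.K).L : ℕ) : ℝ) ^ 2 →
      1 ≤ θ.ν.M₁ → 3 * side (F.P p.K).L θ.ν.M₁ 1 ≤ sideχ F θ.ν p (gOfRecord₁₃ F 2 θ.toStage13Params p) 0 →
      (∀ (Ω Λ : ℕ → Set (Site (F.P p.K) 0)) Y ω ω', ω 0 = ω' 0 → (θ.Zh p 1 Ω Λ).ζ0 0 Y ω = (θ.Zh p 1 Ω Λ).ζ0 0 Y ω') →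
      ∀ s' : SeqOfRecord F θ.ν θ.τ9.M (gOfRecord₁₃ F 2 θ.toStage13Params p) p.K 1, s'.Ω 1 = Set.univ → s'.Λ 1 = Set.univ →
        slotsOfRecord F 2 θ.ν θ.τ9 (EOfRecord₁₃ F 2 θ.toStage13Params) (wOfRecord₉ F 2 θ.toStage9Params) θ.ppSel p (gOfRecord₁₃ F 2 θ.toStage13Params p) 1 s' = 0 ∨
          ∀ᵐ V' ∂fieldMeasure (F.P p.K) 1 (SU 2),
            chiSeqOfRecord F 2 θ.ν θ.τ9.M (gOfRecord₁₃ F 2 θ.toStage13Params p) p.K 1 s' V' ≠ 0 →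
              slotsOfRecord F 2 θ.ν θ.τ9 (EOfRecord₁₃ F 2 θ.toStage13Params) (wOfRecord₉ F 2 θ.toStage9Params) θ.ppSel p (gOfRecord₁₃ F 2 θ.toStage13Params p) 1 s' V' = 0 := by
  obtain ⟨γ, hγ, hall⟩ := hB.1
  refine ⟨γ, hγ, fun p hflow hK1 hM hM₂ α₀ hα hα3 hα2 hαε hαr hε₁ hmK hε hε3 hε2 hM1 h3 hzh s' hΩ hΛ => ?_⟩
  have h2 : ((datumOfRecord₁₃SepCoPH F 2 θ h).C p).Sect2Form 1 := hall p hflow 1 hK1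
  have hSL : SLaw₁₃CoPH F 2 θ p 1 := (sLaw₁₃CoPH_iff F 2 θ p 1).2 ((sect2Form_stage13SepCoPH_iff F 2 θ h p 1).1 h2)
  exact sLaw₁₃CoPH_one_top_pair_degenerate_su2 θ p hzh hM hM₂ hK1 hα hα3 hα2 hαε hαr hε₁ hmK hε hε3 hε2 hM1 h3 hSL s' hΩ hΛ

/-- ★★★★★★ **… AND WITH K1⁹'s NON-VACUITY WINDOW SUCH A RUN EXISTS**: **(v1.1, T0′ of the FLAG №1 R2b cure: plus the DISPLAYED one-scale law of the step-1 residuals — after the cure the proviso row `zhLocal` is print's two-scale law and no longer yields it.)** K1⁹'s (B) conjunct and its window conjunct «`∃ γ₁ > 0, ∀ γ ∈ (0, γ₁], ∃ P, 1 ≤ P.K ∧ flow_P` in the `γ`-window»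
give a run `P` with `1 ≤ P.K` along which — under the numerics guards at `P` — every top pair's post-𝐑 slot of `ρ₁` is the zero function or vanishes a.e. on its support.
[cite: Balaban1989LargeFieldII, Thm 1 p.355; Balaban1988Convergent, Thm 1 p.262, (3.1)–(3.5) pp.264–265, p.267; Balaban1989LargeFieldI, (0.3) p.176; Balaban1985Averaging, Prop. 2 (52)–(54) p.26] -/
theorem exists_run_top_pair_degenerate_of_endStatementBPrinted_su2 (hB : B16.EndStatementBPrinted (datumOfRecord₁₃SepCoPHV F 2 θ h v).C)
    (hW : ∃ γ₁ : ℝ, 0 < γ₁ ∧ ∀ γ : ℝ, 0 < γ → γ ≤ γ₁ → ∃ P : B12.RunParams, 1 ≤ P.K ∧ ((datumOfRecord₁₃SepCoPHV F 2 θ h v).C P).flow.InInterval γ P.K) :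
    ∃ P : B12.RunParams, 1 ≤ P.K ∧
      (1 ≤ θ.τ9.M → 0 < θ.ν.M₂ → ∀ {α₀ : ℝ}, 0 < α₀ →
      (143 * (((((F.P P.K).d + 4 : ℕ) : ℝ)) ^ 2 / 4) ^ 2) * α₀ ≤ 1 / 3 →
      2 * α₀ ≤ 2 * deltaSU (Fin 2) / ((((F.P P.K).d + 4) * (F.P P.K).L : ℕ) : ℝ) ^ 2 →
      epsOfRecord θ.ν (gOfRecord₁₃ F 2 θ.toStage13Params P) 1 * (F.P P.K).eta 1 ^ 2 + 4 * (2 * deltaOfRecord θ.ν (gOfRecord₁₃ F 2 θ.toStage13Params P) 0 θ.A₁) ≤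
        α₀ * (F.P P.K).eta 1 ^ 2 →
      2 * α₀ * (((F.P P.K).L : ℝ) ^ 1 * (F.P P.K).eta 1) ^ 2 ≤ 2 * θ.ν.εreg →
      0 < epsOfRecord θ.ν (gOfRecord₁₃ F 2 θ.toStage13Params P) 1 * (F.P P.K).eta 1 ^ 2 → 1 ≤ (F.P P.K).m + (F.P P.K).K → 0 < θ.ν.εreg →
      (143 * (((((F.P P.K).d + 4 : ℕ) : ℝ)) ^ 2 / 4) ^ 2) * θ.ν.εreg ≤ 1 / 3 →
      2 * θ.ν.εreg ≤ 2 * deltaSU (Fin 2) / ((((F.P P.K).d + 4) * (F.P P.K).L : ℕ) : ℝ) ^ 2 →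
      1 ≤ θ.ν.M₁ → 3 * side (F.P P.K).L θ.ν.M₁ 1 ≤ sideχ F θ.ν P (gOfRecord₁₃ F 2 θ.toStage13Params P) 0 →
      (∀ (Ω Λ : ℕ → Set (Site (F.P P.K) 0)) Y ω ω', ω 0 = ω' 0 → (θ.Zh P 1 Ω Λ).ζ0 0 Y ω = (θ.Zh P 1 Ω Λ).ζ0 0 Y ω') →
      ∀ s' : SeqOfRecord F θ.ν θ.τ9.M (gOfRecord₁₃ F 2 θ.toStage13Params P) P.K 1, s'.Ω 1 = Set.univ → s'.Λ 1 = Set.univ →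
        slotsOfRecord F 2 θ.ν θ.τ9 (EOfRecord₁₃ F 2 θ.toStage13Params) (wOfRecord₉ F 2 θ.toStage9Params) θ.ppSel P (gOfRecord₁₃ F 2 θ.toStage13Params P) 1 s' = 0 ∨
          ∀ᵐ V' ∂fieldMeasure (F.P P.K) 1 (SU 2),
            chiSeqOfRecord F 2 θ.ν θ.τ9.M (gOfRecord₁₃ F 2 θ.toStage13Params P) P.K 1 s' V' ≠ 0 →
              slotsOfRecord F 2 θ.ν θ.τ9 (EOfRecord₁₃ F 2 θ.toStage13Params) (wOfRecord₉ F 2 θ.toStage9Params) θ.ppSel P (gOfRecord₁₃ F 2 θ.toStage13Params P) 1 s' V' = 0) := by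
  obtain ⟨γ, hγ, hall⟩ := endStatementBPrinted_top_pair_degenerate_su2 θ h v hB
  obtain ⟨γ₁, hγ₁, hwin⟩ := hW
  obtain ⟨P, hPK, hPflow⟩ := hwin (min γ γ₁) (lt_min hγ hγ₁) (min_le_right _ _)
  exact ⟨P, hPK, fun hM hM₂ α₀ hα hα3 hα2 hαε hαr hε₁ hmK hε hε3 hε2 hM1 h3 hzh s' hΩ hΛ =>
    hall P (B14Cor3.inInterval_of_le hPflow (min_le_left _ _)) hPK hM hM₂ hα hα3 hα2 hαε hαr hε₁ hmK hε hε3 hε2 hM1 h3 hzh s' hΩ hΛ⟩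

end K1Face

end Summit.QuantumFields.YangMills.Theorems.BalabanUVNodesN11TopPairLocalResidualPostR

end
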